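import Summits.AtomisticToContinuum.Crystallization.Theorems.HolmgrenBoyleLindGroundStatesChargeFLCEquilibriumOfChargePeriodic
import Summits.AtomisticToContinuum.Crystallization.Theses.CrystalKissingRigidity

/-!
# Crux `HolmgrenBoyleLind.GroundStatesChargeFLCEquilibrium` (stmt-AtomisticToContinuum-6076)
# and the shared hinge `GroundStatesChargePeriodic` (stmt-AtomisticToContinuum-2911)
# from the hinge `BulkDefectVanish` (stmt-AtomisticToContinuum-0751)

The route text of `HolmgrenBoyleLind` records that the crux LIM is "mooted by `BulkDefectVanish`
(0751) proved elsewhere"; this file puts that closure edge in the tree (it was absent):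

* `zero_mem_points_of_forall_exists_norm_le` — a uniformly discrete point set containing points of
  arbitrarily small norm contains `0` (applied to the point set of a periodic configuration);
* `exists_norm_le_of_bulkMatched` — a particle whose `R`-neighbourhood is two-way `ε`-matched
  with `x_i + A(P.points ∩ B_R)` (the matching predicate of `BulkDefectVanish`, base point the
  ORIGIN) sees a point of `P.points` of norm `≤ ε` (self-matching of `x_i`);
* `zero_mem_points_of_bulkDefectVanish` — hence the periodic configuration `P` of
  `BulkDefectVanish` has `0 ∈ P.points` (the refuter's "vertex at the origin" remark on 0751, now a
  lemma): good particles exist for large `N` at every tolerance;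
* `half_mul_le_natCard_of_natCard_not_div_lt` — counting: if fewer than half of the indices are
  bad then at least half are good;
* `groundStatesChargePeriodic_of_bulkDefectVanish : BulkDefectVanish → GroundStatesChargePeriodic`
  — with `Q := P`, base point `q := 0 ∈ P.points`, density `ρ := 1/2`, eventually (hence
  frequently) in `N`;
* `groundStatesChargeFLCEquilibrium_of_bulkDefectVanish : BulkDefectVanish →
  GroundStatesChargeFLCEquilibrium` — composed with the landed
  `groundStatesChargeFLCEquilibrium_of_groundStatesChargePeriodic` (p145894).

`BulkDefectVanish` is stated verbatim in ten route files (CrystalKissingRigidity,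
PoissonBesselStacking, CrystalThreeCone, LinkCensus, OctetTrussRigidity, LuttingerTiszaRegistry,
PRVarianceCertificate, ThreeConeCertificate, FrustrationRangeCertificates, HcpDefectCounting); the
copies are syntactically identical, so the theorems below (stated for
`CrystalKissingRigidity.BulkDefectVanish`, the item's first route) transfer by `Iff.rfl`.
CONDITIONAL results (0751 is open); all `[folklore]` glue; nothing here closes an item.
-/

noncomputable section

open MeasureTheory Filter
open scoped ENNReal Topology

namespace Summit.AtomisticToContinuum.Crystallization.Theorems.HolmgrenBoyleLindGroundStatesChargeFLCEquilibrium

open Literature.MathematicalPhysics.StatisticalMechanics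

/-! ### `0 ∈ P.points` is forced by the origin-based matching of `BulkDefectVanish` -/

/-- A uniformly discrete set containing points of arbitrarily small norm contains the origin: a
point `p₁` of norm `≤ δ/3` and a point `p₂` of norm `≤ ‖p₁‖/2` are `δ`-close, hence equal, hence
`p₁ = 0`. [folklore] -/
theorem zero_mem_of_separated_of_forall_exists_norm_le {d : ℕ} {Λ : Set (EuclideanSpace ℝ (Fin d))}
    {δ : ℝ} (hδ : 0 < δ) (hsep : ∀ x ∈ Λ, ∀ y ∈ Λ, x ≠ y → δ ≤ dist x y)
    (h : ∀ ε : ℝ, 0 < ε → ∃ p ∈ Λ, ‖p‖ ≤ ε) : (0 : EuclideanSpace ℝ (Fin d)) ∈ Λ := by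
  obtain ⟨p₁, hp₁, hp₁δ⟩ := h (δ / 3) (by positivity)
  by_cases hp : p₁ = 0
  · exact hp ▸ hp₁
  · have hpos : 0 < ‖p₁‖ := norm_pos_iff.2 hp
    obtain ⟨p₂, hp₂, hp₂le⟩ := h (‖p₁‖ / 2) (by positivity)
    have hne : p₁ ≠ p₂ := by
      intro h12
      rw [← h12] at hp₂le
      linarith
    have hdist : dist p₁ p₂ < δ :=
      calc dist p₁ p₂ ≤ ‖p₁‖ + ‖p₂‖ := dist_le_norm_add_norm p₁ p₂
        _ < δ := by linarith
    exact absurd (hsep p₁ hp₁ p₂ hp₂ hne) (not_le.2 hdist)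

/-- For a periodic configuration: if `P.points` has points of arbitrarily small norm then
`0 ∈ P.points` (uniform discreteness `PeriodicConfiguration.exists_pos_le_dist`). [folklore] -/
theorem zero_mem_points_of_forall_exists_norm_le {d : ℕ} (P : PeriodicConfiguration d)
    (h : ∀ ε : ℝ, 0 < ε → ∃ p ∈ P.points, ‖p‖ ≤ ε) :
    (0 : EuclideanSpace ℝ (Fin d)) ∈ P.points := by
  obtain ⟨δ, hδ, hsep⟩ := P.exists_pos_le_dist
  exact zero_mem_of_separated_of_forall_exists_norm_le hδ hsep h

/-- **Self-matching.** If the `R`-neighbourhood (`R ≥ 0`) of particle `i` is `ε`-matched INTO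
`x_i + A(Λ)` (the second clause of the `BulkDefectVanish` predicate, base point the origin), then
`Λ` has a point of norm `≤ ε`: the particle `x_i` itself is matched. [folklore] -/
theorem exists_norm_le_of_bulkMatched {N : ℕ} {x : Fin N → EuclideanSpace ℝ (Fin 3)} {i : Fin N}
    {Λ : Set (EuclideanSpace ℝ (Fin 3))} {R ε : ℝ} (hR : 0 ≤ R)
    {A : EuclideanSpace ℝ (Fin 3) →ₗᵢ[ℝ] EuclideanSpace ℝ (Fin 3)}
    (h : ∀ j : Fin N, dist (x j) (x i) ≤ R → ∃ p ∈ Λ, dist (x j) (x i + A p) ≤ ε) :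
    ∃ p ∈ Λ, ‖p‖ ≤ ε := by
  obtain ⟨p, hp, hpi⟩ := h i (by rwa [dist_self])
  refine ⟨p, hp, ?_⟩
  rwa [dist_eq_norm, sub_add_cancel_left, norm_neg, LinearIsometry.norm_map] at hpi

/-- **`BulkDefectVanish` forces a vertex at the origin.** If a periodic configuration `P` has the
`BulkDefectVanish` property along ONE sequence of configurations `x` with `N`-th term of size `N`
(for all `R, ε > 0` the fraction of particles NOT two-way `(R, ε)`-matched with
`x_i + A(P.points ∩ B_R)` tends to `0`), then `0 ∈ P.points`: for every `ε`, at large `N` a good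
particle exists and is self-matched to a point of norm `≤ ε`. [folklore] -/
theorem zero_mem_points_of_bulkDefectVanish (P : PeriodicConfiguration 3)
    (x : (N : ℕ) → (Fin N → EuclideanSpace ℝ (Fin 3)))
    (hP : ∀ R ε : ℝ, 0 < R → 0 < ε → Filter.Tendsto (fun N : ℕ => (Nat.card {i : Fin N //
      ¬ ∃ A : EuclideanSpace ℝ (Fin 3) →ₗᵢ[ℝ] EuclideanSpace ℝ (Fin 3),
        (∀ p ∈ P.points, ‖p‖ ≤ R → ∃ j : Fin N, dist (x N j) (x N i + A p) ≤ ε) ∧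
        (∀ j : Fin N, dist (x N j) (x N i) ≤ R →
          ∃ p ∈ P.points, dist (x N j) (x N i + A p) ≤ ε)} : ℝ) / N)
      Filter.atTop (nhds 0)) :
    (0 : EuclideanSpace ℝ (Fin 3)) ∈ P.points := by
  classical
  refine zero_mem_points_of_forall_exists_norm_le P fun ε hε => ?_
  have hev := (hP 1 ε one_pos hε).eventually (gt_mem_nhds (show (0 : ℝ) < 1 from one_pos))
  obtain ⟨N, hN, hN1⟩ := (hev.and (Filter.eventually_ge_atTop 1)).exists
  -- fewer than `N` bad indices among `N`: a good one exists
  have hNpos : (0 : ℝ) < N := by exact_mod_cast hN1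
  rw [div_lt_one hNpos] at hN
  set bad : Fin N → Prop := fun i => ¬ ∃ A : EuclideanSpace ℝ (Fin 3) →ₗᵢ[ℝ] EuclideanSpace ℝ (Fin 3),
      (∀ p ∈ P.points, ‖p‖ ≤ 1 → ∃ j : Fin N, dist (x N j) (x N i + A p) ≤ ε) ∧
      (∀ j : Fin N, dist (x N j) (x N i) ≤ 1 → ∃ p ∈ P.points, dist (x N j) (x N i + A p) ≤ ε)
    with hbad
  have hlt : Nat.card {i : Fin N // bad i} < N := by exact_mod_cast hN
  by_contra h0
  -- if `0 ∉`-witnessing fails, every index is bad, so the bad count is `N`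
  have hall : ∀ i : Fin N, bad i := by
    intro i hi
    obtain ⟨A, -, hA₂⟩ := hi
    exact h0 (exists_norm_le_of_bulkMatched zero_le_one hA₂)
  have hcard : Nat.card {i : Fin N // bad i} = N := by
    rw [Nat.card_congr (Equiv.subtypeUnivEquiv hall), Nat.card_eq_fintype_card, Fintype.card_fin]
  exact absurd hcard hlt.ne

/-! ### Counting: fewer than half bad ⇒ at least half good -/

/-- If fewer than half of the `N` indices satisfy `¬ good` then at least `N/2` satisfy `good`
(`#good + #bad = N`). [folklore] -/
theorem half_mul_le_natCard_of_natCard_not_div_lt {N : ℕ} (good : Fin N → Prop)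
    (h : (Nat.card {i : Fin N // ¬ good i} : ℝ) / N < 1 / 2) :
    1 / 2 * (N : ℝ) ≤ (Nat.card {i : Fin N // good i} : ℝ) := by
  classical
  rcases Nat.eq_zero_or_pos N with hN | hN
  · subst hN; simp
  have hNpos : (0 : ℝ) < N := by exact_mod_cast hN
  rw [div_lt_iff₀ hNpos] at h
  have hsum : (Nat.card {i : Fin N // good i} : ℝ) + (Nat.card {i : Fin N // ¬ good i} : ℝ) = N := by
    rw [Nat.card_eq_fintype_card, Nat.card_eq_fintype_card, Fintype.card_subtype_compl,
      Nat.cast_sub (Fintype.card_subtype_le _), Fintype.card_fin]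
    ring
  linarith

/-! ### The hinge and the crux from `BulkDefectVanish` -/

/-- **`BulkDefectVanish` (0751) ⇒ `GroundStatesChargePeriodic` (2911)** — CONDITIONAL on the open
hinge 0751 (shared by ten routes). Given the periodic configuration `P` of `BulkDefectVanish` and a
ground-state sequence `x`: `0 ∈ P.points` (`zero_mem_points_of_bulkDefectVanish`), so the
origin-based matching predicate of 0751 at `(R, ε)` is the base-point predicate of 2911 with
`Q := P`, `q := 0` (`s - 0 = s`); the bad fraction tends to `0`, so eventually it is `< 1/2` and at
least `N/2` particles are good (`ρ := 1/2`), and eventually implies frequently. [folklore] -/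
theorem groundStatesChargePeriodic_of_bulkDefectVanish :
    Summit.AtomisticToContinuum.Crystallization.Theses.CrystalKissingRigidity.BulkDefectVanish →
    Summit.AtomisticToContinuum.Crystallization.Theses.HolmgrenBoyleLind.GroundStatesChargePeriodic := by
  classical
  rintro ⟨P, hP⟩ x hx
  have h0 : (0 : EuclideanSpace ℝ (Fin 3)) ∈ P.points :=
    zero_mem_points_of_bulkDefectVanish P x fun R ε hR hε => hP R ε hR hε x hx
  refine ⟨P, fun R ε hR hε => ⟨1 / 2, one_half_pos, ?_⟩⟩
  have hev := (hP R ε hR hε x hx).eventually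
    (gt_mem_nhds (show (0 : ℝ) < 1 / 2 from one_half_pos))
  refine Filter.Eventually.frequently ?_
  filter_upwards [hev] with N hN
  -- the 0751-good particles are 2911-good with base point `q := 0`
  set good : Fin N → Prop := fun i =>
      ∃ A : EuclideanSpace ℝ (Fin 3) →ₗᵢ[ℝ] EuclideanSpace ℝ (Fin 3),
        (∀ p ∈ P.points, ‖p‖ ≤ R → ∃ j : Fin N, dist (x N j) (x N i + A p) ≤ ε) ∧
        (∀ j : Fin N, dist (x N j) (x N i) ≤ R → ∃ p ∈ P.points, dist (x N j) (x N i + A p) ≤ ε)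
    with hgood
  have hhalf : 1 / 2 * (N : ℝ) ≤ (Nat.card {i : Fin N // good i} : ℝ) :=
    half_mul_le_natCard_of_natCard_not_div_lt good hN
  refine hhalf.trans ?_
  set good' : Fin N → Prop := fun i =>
      ∃ A : EuclideanSpace ℝ (Fin 3) →ₗᵢ[ℝ] EuclideanSpace ℝ (Fin 3), ∃ q ∈ P.points,
        (∀ s ∈ P.points, dist s q ≤ R → ∃ j : Fin N, dist (x N j) (x N i + A (s - q)) ≤ ε) ∧
        (∀ j : Fin N, dist (x N j) (x N i) ≤ R →
          ∃ s ∈ P.points, dist (x N j) (x N i + A (s - q)) ≤ ε)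
    with hgood'
  have himp : ∀ i : Fin N, good i → good' (id i) := by
    rintro i ⟨A, hA₁, hA₂⟩
    refine ⟨A, 0, h0, fun s hs hsR => ?_, fun j hj => ?_⟩
    · rw [dist_zero_right] at hsR
      simpa only [sub_zero, id] using hA₁ s hs hsR
    · simpa only [sub_zero, id] using hA₂ j hj
  exact_mod_cast Nat.card_le_card_of_injective (Subtype.map id himp)
    (Subtype.map_injective himp Function.injective_id)

/-- **`BulkDefectVanish` (0751) ⇒ the crux `GroundStatesChargeFLCEquilibrium` (6076)** —
CONDITIONAL on the open hinge 0751: the closure edge "mooted by 0751" of the route text, composed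
from `groundStatesChargePeriodic_of_bulkDefectVanish` and the landed
`groundStatesChargeFLCEquilibrium_of_groundStatesChargePeriodic` (2911 ⇒ crux). [folklore] -/
theorem groundStatesChargeFLCEquilibrium_of_bulkDefectVanish :
    Summit.AtomisticToContinuum.Crystallization.Theses.CrystalKissingRigidity.BulkDefectVanish →
    Summit.AtomisticToContinuum.Crystallization.Theses.HolmgrenBoyleLind.GroundStatesChargeFLCEquilibrium :=
  fun h => groundStatesChargeFLCEquilibrium_of_groundStatesChargePeriodic
    (groundStatesChargePeriodic_of_bulkDefectVanish h)

end Summit.AtomisticToContinuum.Crystallization.Theorems.HolmgrenBoyleLindGroundStatesChargeFLCEquilibrium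

end
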